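import Summits.BirchSwinnertonDyer.Rank1Residual.X12.O11.RouteUPrimeMember
import Summits.BirchSwinnertonDyer.Rank1Residual.X11b.AnticyclotomicEmbedding
import HarnessLib

/-!
# ROUTE U — the `7`-adic embedding binder `ιp : K ↪ ℚ₇` DISCHARGED (it exists because `7` splits in `K`)

bsd-cm cell (run/shared/lean/pub/bsd-cm/), ROUTE U, seat `bsd-cm-ram`. The member theorems display the
data binder `ιp : K →+* ℚ_[7]` (used only to transport `W(K)[7] = 0` from `W(ℚ₇)[7] = 0`). Since `7`
splits in the Heegner field `K = ℚ(√−r)` (`(−r/7) = 1`, `RouteU.ncard_primesOver_eq_two_of_legendreSym`),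
a degree-one prime `𝔭 ∣ 7` exists (`X11b.exists_degreeOnePrime_of_splitsIn`) and THE embedding
`X11b.embAt K 7 𝔭 … : K →+* ℚ_[7]` (sibling cell b2b-bsdres, `K → K_𝔭 ≃ ℚ₇`) serves. Hence
`forall_bsdp_of_twist_cm7_prime'` = `forall_bsdp_of_twist_cm7_prime` WITHOUT the binder `ιp`.
THEOREMS ONLY; nothing booked. References: [FrohlichTaylor1990] III §1 (1.14)(a); [Castella2018] §2.2.
-/

noncomputable section

open scoped Classical
open NumberField WeierstrassCurve DirichletCharacter
open Literature.NumberTheory.EllipticCurves Literature.NumberTheory.EllipticCurves.Rank1Residual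
open Literature.NumberTheory.EllipticCurves.KrizLi2019 Literature.NumberTheory.LFunctions
open Literature.NumberTheory.EllipticCurves.ModularForms

namespace Summit.BirchSwinnertonDyer.Rank1Residual.X12.O11.RouteU

/-- **FULL BSD for the prime members, with the embedding `K ↪ ℚ₇` produced inside** (one data binder
fewer than `forall_bsdp_of_twist_cm7_prime`): `7` splits in `K = ℚ(√−r)` by `(−r/7) = 1`, so a degree-one
prime `𝔭 ∣ 7` of `𝓞_K` exists and `X11b.embAt K 7 𝔭` is an embedding `K →+* ℚ_[7]`.
[cite: FrohlichTaylor1990, Ch. III §1 (1.14)(a)] [cite: Miller2011LMS, §1 and Def. 1.1] -/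
theorem forall_bsdp_of_twist_cm7_prime' {q r : ℕ} [hq : Fact q.Prime] [hr : Fact r.Prime]
    (hq4 : q % 4 = 3) (hr4 : r % 4 = 3) (hq7 : q ≠ 7) (hr7 : r ≠ 7) (hr3 : r ≠ 3) (hqr : q ≠ r)
    (h7split : legendreSym 7 (-(r : ℤ)) = 1) (hqsplit : legendreSym q (-(r : ℤ)) = 1)
    (hsq : legendreSym q (-7) = 1)
    (hcert₁ : ∀ (ω : DirichletCharacter ℚ_[7] 7), IsTeichmullerCharacter ω →
      ∀ θ : DirichletCharacter ℚ_[7] (7 * q),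
        (∀ j : ZMod (7 * q), θ j = (legendreSym q (j.val : ℤ) : ℚ_[7]) * ω (j.val : ZMod 7) ^ 4) →
        ‖generalizedBernoulli 1 θ‖ = 1)
    (hcert₂ : ∀ (ω : DirichletCharacter ℚ_[7] 7), IsTeichmullerCharacter ω →
      ∀ θ : DirichletCharacter ℚ_[7] (7 * q * r),
        (∀ j : ZMod (7 * q * r), θ j =
          ((legendreSym q (j.val : ℤ) * jacobiSym (j.val : ℤ) r : ℤ) : ℚ_[7]) * ω (j.val : ZMod 7) ^ 1) →
        ‖generalizedBernoulli 1 θ‖ = 1)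
    (hKL : KrizLi2019.thm120_padicLogHeegner_unit_of_bernoulli)
    (hRem : KrizLi2019.rem310_padicLogHeegner_integral)
    (W : WeierstrassCurve ℚ) [W.IsElliptic] [W.IsGloballyMinimal] [NeZero (W.conductorNorm ℤ)]
    (hW : ∃ C : VariableChange ℚ, C • W = cm7.quadraticTwist ((-(q : ℤ) : ℤ) : ℚ))
    (K : Type) [Field K] [NumberField K] [NeZero (NumberField.discr K).natAbs]
    (hK : IsImaginaryQuadratic K) (hdK : NumberField.discr K = -(r : ℤ))
    (D : ModularParametrizationData W (W.conductorNorm ℤ))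
    (H : HeegnerDatum (W.conductorNorm ℤ) (NumberField.discr K)) (ι : K →+* ℂ)
    (P : (W.baseChange K).toAffine.Point)
    (hGZ : gross_zagier (W.conductorNorm ℤ) W K) (hKo : kolyvagin (W.conductorNorm ℤ) W K)
    (hGZK : rank_eq_analyticRank_of_analyticRank_le_one) (hmod : hasEntireLFunction_rat)
    (hP : WeierstrassCurve.Affine.Point.map ι.toRatAlgHom P = heegnerPointComplex D H)
    (hr1 : W.analyticRank = 1)
    (hLt : (W.quadraticTwist (NumberField.discr K : ℚ)).entireLFunction 1 ≠ 0)
    (Wd : WeierstrassCurve ℚ) [Wd.IsElliptic] [Wd.IsGloballyMinimal] (Cd : VariableChange ℚ)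
    (hWd : Cd • W.quadraticTwist (NumberField.discr K : ℚ) = Wd)
    (hBF : bsdTriple_of_hasCM_of_L_one_ne_zero)
    (hu : padicValRat 7 (Cd.u : ℚ) = 0)
    (hC : Rubin1983.thmC_seven_quadraticField)
    (hBG : BuhlerGross1985.firstDescent_seven_oddTwist_of_bernoulli)
    [Finite (AddCommGroup.torsion (W.baseChange K).toAffine.Point)]
    (crd : (W.baseChange K).toAffine.Point →+ ℤ) (g : (W.baseChange K).toAffine.Point)
    (hg : crd g = 1) (hker : ∀ x, crd x = 0 → IsOfFinAddOrder x)
    (hc7 : ¬ ((7 : ℤ) ∣ D.c)) (hLLT : LiLiuTian2024.thm11_bsdp_of_cm_rank_one)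
    (hKob : Kobayashi2013.cor14_bsdp_of_cm_rank_one) (hLTYZ : LiTianYanZhu2025.thm11_bsdp_of_cm_rank_one) :
    ∀ p : ℕ, p.Prime → BSDp W p := by
  haveI : Fact (Nat.Prime 7) := ⟨by norm_num⟩
  have h7K : ((Ideal.span {(7 : ℤ)}).primesOver (𝓞 K)).ncard = 2 := by
    have := ncard_primesOver_eq_two_of_legendreSym hK (ℓ := 7) (by norm_num) (by rw [hdK]; exact h7split)
    exact_mod_cast this
  obtain ⟨𝔭, h𝔭, he, hf⟩ := X11b.exists_degreeOnePrime_of_splitsIn K 7 hK.1 h7K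
  exact forall_bsdp_of_twist_cm7_prime hq4 hr4 hq7 hr7 hr3 hqr h7split hqsplit hsq hcert₁ hcert₂ hKL hRem W
    hW K hK hdK D H ι (X11b.embAt K 7 𝔭 h𝔭 he hf) P hGZ hKo hGZK hmod hP hr1 hLt Wd Cd hWd hBF hu hC hBG
    crd g hg hker hc7 hLLT hKob hLTYZ

end Summit.BirchSwinnertonDyer.Rank1Residual.X12.O11.RouteU

end
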